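import Summits.QuantumFields.BalabanUV.Beta.FP.PackedLegFullIndex

/-!
# `BalabanUV.Beta.FP.PackedLawFullIndex` — road «FP» for binder row D1, ROUTE T, memo `N2B-DESIGN.md` (34h) STEP 3, letter (S3-3): **THE ASSEMBLY SOCKET ON THE
# FIBRED TORUS INDEX** — from the adapters' `hessT` law on the PACKED sorts (#37 `LevelZeroDoorSocketU23Pure` ∕ #37c `LevelZeroDoorSocketCompanion`: graded
# first-order blocks `fromBlocks H₁ (−Q₁₁ᵀ) Q₁₁ 0`, `kkt`-shaped second-order blocks, legs = the `(fields ⊕ multiplier-bonds)` blocks of the right inverses) to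
# the law `hessT (perF M_N A_N) D̂_N D̂_N′ Ŵ_N = hessT (perF M_F A_F) D̂_F D̂_F′ Ŵ_F + hessT (perF M_G A_G) D̂_G D̂_G′ Ŵ_G` on the three fibred torus indices
# `Idx M_X (Fib d)` with UNTWISTED full-index jets — the currency of (P2‴) `KernelPeriodisationFibHessKer.hessKer_law_of_torus_hessT_law`'s `hlaw`

WHY.  leaf-06's `PackedLegFullIndex.hessT_packedLeg_eq_perF` moves ONE system from the packed sorts `(pbox M × Fin (d+1)) ⊕ μ` to `Idx M (Fib d)` GIVEN its
jets as restrictions `V.submatrix e♯ e♯` along the packing injection `e♯ = Sum.elim (b ↦ (b.1, inl b.2)) fμ`, at the price of a uniform right SIGN TWIST `D_σ`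
(`+1` on field slots, `−1` on multiplier slots) on all three jets.  The door's jets are not given as restrictions but as BLOCKS: the first-order vertex is
GRADED, `fromBlocks H₁ (−Q₁₁ᵀ) Q₁₁ 0`, the second-order slot is `kkt`-shaped, `fromBlocks H₂ Q₁₂ᵀ Q₁₂ 0`.  THIS FILE supplies the two block letters that turn
blocks into twisted restrictions — under exactly the PARITIES the (J-a) dictionary exhibits at the record (an2's «parity-odd word», W-an2-g45-9 (2); letters 2d
`CombHId2TorusTwin` (L1a)(L2a); leaf-05's J2-record sockets `hDmm hDfm hWmm hWfm`): a full-index first-order matrix `D̂` that is `μμ`-FREE on `range fμ` with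
SYMMETRIC field∕multiplier twin reads `fromBlocks (D̂|ff) (−(D̂|μf)ᵀ) (D̂|μf) 0 = (D̂·D_σ).submatrix e♯ e♯` (§2 (V)); a second-order `Ŵ` `μμ`-free with
ANTISYMMETRIC twin reads `kkt (Ŵ|ff) (Ŵ|μf) = (Ŵ·D_σ).submatrix e♯ e♯` (§2 (W)); and `D_σ·D_σ = 1` (§1), so after leaf-06's transfer the jets come out
UNTWISTED.  §2b is ONE system across (`hessT_packedLeg_blocks_eq_perF` — leaf-06 g27's S-1: the composite door's systems arrive one at a
time); §3 is the socket: three systems, each with its torus, packing injection, chart kernel under the torus rules `Ê·Â = Â = Â·Ê`, and full-index jets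
with the parities DISPLAYED; the packed law (the adapters' conclusion SHAPE, legs in leaf-06's `fromBlocks Γ♯ I♯ L♯ (−S♯)` form over `perF M_X A_X`) ⟹ the
full-index law.  [folklore] finite block bookkeeping; no `def`, no `def … : Prop`, nothing cited, 0 sorry; 0 estimates.  NOT HERE: the (J-a) NAMINGS of
`D̂_X ∕ Ŵ_X` as `perF M_X (dper M_X 𝒱)` of bi-localised lattice kernels (an2 C2a∕b∕c + PART THREE; the OWNER's #38∕#38b∕#38c pack them AT THE RECORD), the
leg presentations (S3-1) (leaf-05 `RelInvPeriodised*` + leaf-06), the rows of the door (hypotheses of the adapters), (P2‴) itself.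

HONEST DEPENDENCY (page 1, mandatory): continuum YM on T⁴ ⇐ BetaPertH ∧ nine spine estimates (0/9 proved); BetaPertH ⇐ (D1) ∧ (D4) ∧ CAP+tail;
G-an2-4 gates asym, D1 and NE2/3/4.  HONEST FRAMING (cell contract, verbatim): «discharging `BetaPertH` makes Bałaban's UV stability UNCONDITIONAL —
a real constructive-QFT result; it is NOT the continuum limit and NOT the Clay problem.»  ABSOLUTE RULE (cell charter, verbatim): «No internally-minted
statement may enter as a cited fact. Every hypothesis is either kernel-proved in this package or a verbatim quotation of a PUBLISHED theorem with page
reference. The manuscript(s) under audit are NOT citable for their own disputed steps — they are the thing under adjudication; programme-internal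
(2001/route/tribunal) claims are never citable.»  Nothing of the dictionary's identification ∕ Bałaban's asserted; the parities and the packed law are
HYPOTHESES here; 0∕4 row-D1 binders (hW, hR, D1Tel, D1Rep); NOT (T-ID), NOT SDF, NOT D1, NOT BetaPertH, NOT continuum, NOT Clay.  Road «FP» OWNER,
b2b-balaban-beta-d1-p3 gen 26, 2026-08-23.  No existing file touched.
-/

noncomputable section

open scoped BigOperators Matrix

namespace Summit.QuantumFields.BalabanUV.Beta.FP.PackedLawFullIndex

open Matrix
open Literature.Probability.LatticeModels (Torus.proj)
open Literature.MathematicalPhysics.QuantumFieldTheory.Balaban1983to89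
open Literature.MathematicalPhysics.QuantumFieldTheory.Balaban1983to89.Beta
open Literature.MathematicalPhysics.QuantumFieldTheory.Balaban1983to89.Beta.Composition (kkt)
open B6Lemma24Torus (pbox)
open ExpKernelCalculus (MKer)
open AffineAveraging (Site)
open OneStepResolventKernel (Fib)
open Summit.QuantumFields.BalabanUV.Beta.AxialDressingRooted (axEc)
open Summit.QuantumFields.BalabanUV.Beta.D1BFx.MixedVarPackedHess (hessT)
open Summit.QuantumFields.BalabanUV.Beta.FP.KernelPeriodisationFib (Idx perF)
open Summit.QuantumFields.BalabanUV.Beta.FP.PackedLegFullIndex (submatrix_packedEmb_eq_fromBlocks hessT_packedLeg_eq_perF)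

/-! ## §1 The sign twist `D_σ` is an involution -/

section Sign

variable {d : ℕ} (M : Fin (d + 1) → ℕ)

/-- [folklore] **`D_σ · D_σ = 1`**: the field∕multiplier sign twist on the fibred torus index is an involution. -/
theorem signDiag_mul_signDiag :
    Matrix.diagonal (fun p : Idx M (Fib d) => Sum.elim (fun _ : Fin (d + 1) => (1 : ℝ)) (fun _ : Fin (d + 1) => (-1 : ℝ)) p.2)
        * Matrix.diagonal (fun p : Idx M (Fib d) => Sum.elim (fun _ : Fin (d + 1) => (1 : ℝ)) (fun _ : Fin (d + 1) => (-1 : ℝ)) p.2) = 1 := by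
  rw [Matrix.diagonal_mul_diagonal, ← Matrix.diagonal_one]
  congr 1
  funext p
  rcases p.2 with α | m <;> simp

/-- [folklore] **twisting twice is the identity**: `(X · D_σ) · D_σ = X`. -/
theorem mul_signDiag_mul_signDiag (X : Matrix (Idx M (Fib d)) (Idx M (Fib d)) ℝ) :
    X * Matrix.diagonal (fun p : Idx M (Fib d) => Sum.elim (fun _ : Fin (d + 1) => (1 : ℝ)) (fun _ : Fin (d + 1) => (-1 : ℝ)) p.2)
      * Matrix.diagonal (fun p : Idx M (Fib d) => Sum.elim (fun _ : Fin (d + 1) => (1 : ℝ)) (fun _ : Fin (d + 1) => (-1 : ℝ)) p.2) = X := by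
  rw [Matrix.mul_assoc, signDiag_mul_signDiag, Matrix.mul_one]

end Sign

/-! ## §2 Blocks as twisted restrictions: (V) the graded first-order block, (W) the `kkt`-shaped second-order block -/

section Blocks

variable {d : ℕ} (M : Fin (d + 1) → ℕ)
variable {μ : Type*} (fμ : μ → Idx M (Fib d))

/-- [folklore] at a multiplier slot `fμ a` the sign is `−1`. -/
theorem signFib_fμ (hμ : ∀ a : μ, ∃ m : Fin (d + 1), (fμ a).2 = Sum.inr m) (a : μ) :
    Sum.elim (fun _ : Fin (d + 1) => (1 : ℝ)) (fun _ : Fin (d + 1) => (-1 : ℝ)) (fμ a).2 = -1 := by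
  obtain ⟨m, hm⟩ := hμ a
  rw [hm, Sum.elim_inr]

/-- [folklore] **(V) `graded_blocks_eq_signTwist_submatrix` — THE DOOR's GRADED FIRST-ORDER BLOCK IS A SIGN-TWISTED RESTRICTION.**  For ANY full-index matrix
`D̂` on `Idx M (Fib d)` that is `μμ`-FREE on `range fμ` (`hmm`) and has SYMMETRIC field∕multiplier twin there (`htwin : D̂ (b̃, fμ a) = D̂ (fμ a, b̃)`, `b̃ = (b.1, inl b.2)`):
`fromBlocks (D̂.sub e_F e_F) (−(D̂.sub fμ e_F)ᵀ) (D̂.sub fμ e_F) 0 = (D̂ · D_σ).submatrix e♯ e♯` — leaf-06 §3 `submatrix_packedEmb_eq_fromBlocks` + the two parities. -/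
theorem graded_blocks_eq_signTwist_submatrix (hμ : ∀ a : μ, ∃ m : Fin (d + 1), (fμ a).2 = Sum.inr m)
    (X : Matrix (Idx M (Fib d)) (Idx M (Fib d)) ℝ)
    (hmm : ∀ a a' : μ, X (fμ a) (fμ a') = 0)
    (htwin : ∀ (b : ↥(pbox M) × Fin (d + 1)) (a : μ), X (b.1, Sum.inl b.2) (fμ a) = X (fμ a) (b.1, Sum.inl b.2)) :
    fromBlocks
        (X.submatrix (fun b : ↥(pbox M) × Fin (d + 1) => ((b.1, Sum.inl b.2) : Idx M (Fib d)))
          (fun b : ↥(pbox M) × Fin (d + 1) => ((b.1, Sum.inl b.2) : Idx M (Fib d))))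
        (-(X.submatrix fμ (fun b : ↥(pbox M) × Fin (d + 1) => ((b.1, Sum.inl b.2) : Idx M (Fib d))))ᵀ)
        (X.submatrix fμ (fun b : ↥(pbox M) × Fin (d + 1) => ((b.1, Sum.inl b.2) : Idx M (Fib d))))
        0
      = (X * Matrix.diagonal (fun p : Idx M (Fib d) => Sum.elim (fun _ : Fin (d + 1) => (1 : ℝ)) (fun _ : Fin (d + 1) => (-1 : ℝ)) p.2)).submatrix
          (Sum.elim (fun b : ↥(pbox M) × Fin (d + 1) => ((b.1, Sum.inl b.2) : Idx M (Fib d))) fμ)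
          (Sum.elim (fun b : ↥(pbox M) × Fin (d + 1) => ((b.1, Sum.inl b.2) : Idx M (Fib d))) fμ) := by
  have hσ := signFib_fμ M fμ hμ
  ext (b | a) (b' | a')
  · simp only [fromBlocks_apply₁₁, submatrix_apply, Sum.elim_inl, mul_diagonal, mul_one]
  · simp only [fromBlocks_apply₁₂, Matrix.neg_apply, Matrix.transpose_apply, submatrix_apply, Sum.elim_inl, Sum.elim_inr, mul_diagonal, hσ, htwin,
      mul_neg, mul_one]
  · simp only [fromBlocks_apply₂₁, submatrix_apply, Sum.elim_inl, Sum.elim_inr, mul_diagonal, mul_one]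
  · simp only [fromBlocks_apply₂₂, Matrix.zero_apply, submatrix_apply, Sum.elim_inr, mul_diagonal, hmm, zero_mul]

/-- [folklore] **(W) `kkt_blocks_eq_signTwist_submatrix` — THE `kkt`-SHAPED SECOND-ORDER BLOCK IS A SIGN-TWISTED RESTRICTION.**  For ANY full-index `Ŵ` that is
`μμ`-free on `range fμ` and has ANTISYMMETRIC twin there (`hanti : Ŵ (b̃, fμ a) = −Ŵ (fμ a, b̃)`):
`kkt (Ŵ.sub e_F e_F) (Ŵ.sub fμ e_F) = (Ŵ · D_σ).submatrix e♯ e♯` (`kkt H Q = fromBlocks H Qᵀ Q 0`). -/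
theorem kkt_blocks_eq_signTwist_submatrix (hμ : ∀ a : μ, ∃ m : Fin (d + 1), (fμ a).2 = Sum.inr m)
    (X : Matrix (Idx M (Fib d)) (Idx M (Fib d)) ℝ)
    (hmm : ∀ a a' : μ, X (fμ a) (fμ a') = 0)
    (hanti : ∀ (b : ↥(pbox M) × Fin (d + 1)) (a : μ), X (b.1, Sum.inl b.2) (fμ a) = -X (fμ a) (b.1, Sum.inl b.2)) :
    kkt (X.submatrix (fun b : ↥(pbox M) × Fin (d + 1) => ((b.1, Sum.inl b.2) : Idx M (Fib d)))
          (fun b : ↥(pbox M) × Fin (d + 1) => ((b.1, Sum.inl b.2) : Idx M (Fib d))))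
        (X.submatrix fμ (fun b : ↥(pbox M) × Fin (d + 1) => ((b.1, Sum.inl b.2) : Idx M (Fib d))))
      = (X * Matrix.diagonal (fun p : Idx M (Fib d) => Sum.elim (fun _ : Fin (d + 1) => (1 : ℝ)) (fun _ : Fin (d + 1) => (-1 : ℝ)) p.2)).submatrix
          (Sum.elim (fun b : ↥(pbox M) × Fin (d + 1) => ((b.1, Sum.inl b.2) : Idx M (Fib d))) fμ)
          (Sum.elim (fun b : ↥(pbox M) × Fin (d + 1) => ((b.1, Sum.inl b.2) : Idx M (Fib d))) fμ) := by
  have hσ := signFib_fμ M fμ hμ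
  unfold kkt
  ext (b | a) (b' | a')
  · simp only [fromBlocks_apply₁₁, submatrix_apply, Sum.elim_inl, mul_diagonal, mul_one]
  · simp only [fromBlocks_apply₁₂, Matrix.transpose_apply, submatrix_apply, Sum.elim_inl, Sum.elim_inr, mul_diagonal, hσ, hanti, mul_neg, mul_one,
      neg_neg]
  · simp only [fromBlocks_apply₂₁, submatrix_apply, Sum.elim_inl, Sum.elim_inr, mul_diagonal, mul_one]
  · simp only [fromBlocks_apply₂₂, Matrix.zero_apply, submatrix_apply, Sum.elim_inr, mul_diagonal, hmm, zero_mul]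

end Blocks

/-! ## §2b One system: the packed leg against the door's blocks IS the unmasked leg against the untwisted jets -/

section OneSystem

variable {d : ℕ} (ρ : Fin (d + 1) → ℤ) (Lc : ℕ) (M : Fin (d + 1) → ℕ) [∀ μ, NeZero (M μ)]
variable {μ : Type*} [Fintype μ] (fμ : μ → Idx M (Fib d))

variable {Lc} in
/-- [folklore] **`hessT_packedLeg_blocks_eq_perF` — ONE SYSTEM ACROSS** (leaf-06 g27 S-1): for a chart kernel `A` under the torus rules and full-index jets
`D̂ D̂′` (`μμ`-free, SYMMETRIC twin) and `Ŵ` (`μμ`-free, ANTISYMMETRIC twin), leaf-06's packed leg over `perF M A` against the GRADED blocks of `D̂ D̂′` and the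
`kkt` blocks of `Ŵ` IS `hessT (perF M A) D̂ D̂′ Ŵ` — leg UNMASKED, jets UNTWISTED (§2 (V)(V)(W) + `PackedLegFullIndex.hessT_packedLeg_eq_perF` + §1).  The socket §3
is three instances; a composite door arriving one system at a time (`NestedFPSplit` ∕ the `j ≥ 2` ladder) uses this lemma directly. -/
theorem hessT_packedLeg_blocks_eq_perF (hfμ : Function.Injective fμ) (hμ : ∀ a : μ, ∃ m : Fin (d + 1), (fμ a).2 = Sum.inr m)
    (hcoarse : ∀ (s : ↥(pbox M)) (m : Fin (d + 1)), ((s, Sum.inr m) : Idx M (Fib d)) ∈ Set.range fμ ↔ Torus.proj Lc (s : Site (d + 1)) = 0)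
    {A : MKer (d + 1) (Fib d)} (hEA : perF M (axEc ρ Lc) * perF M A = perF M A) (hAE : perF M A * perF M (axEc ρ Lc) = perF M A)
    (V V' W : Matrix (Idx M (Fib d)) (Idx M (Fib d)) ℝ)
    (hVm : ∀ a a' : μ, V (fμ a) (fμ a') = 0) (hVt : ∀ (b : ↥(pbox M) × Fin (d + 1)) (a : μ), V (b.1, Sum.inl b.2) (fμ a) = V (fμ a) (b.1, Sum.inl b.2))
    (hV'm : ∀ a a' : μ, V' (fμ a) (fμ a') = 0) (hV't : ∀ (b : ↥(pbox M) × Fin (d + 1)) (a : μ), V' (b.1, Sum.inl b.2) (fμ a) = V' (fμ a) (b.1, Sum.inl b.2))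
    (hWm : ∀ a a' : μ, W (fμ a) (fμ a') = 0) (hWt : ∀ (b : ↥(pbox M) × Fin (d + 1)) (a : μ), W (b.1, Sum.inl b.2) (fμ a) = -W (fμ a) (b.1, Sum.inl b.2)) :
    hessT
        (fromBlocks
          (Matrix.of fun (b b' : ↥(pbox M) × Fin (d + 1)) =>
            axEc ρ Lc (b.1 : Site (d + 1)) (b.1 : Site (d + 1)) (Sum.inl b.2) (Sum.inl b.2)
              * (axEc ρ Lc (b'.1 : Site (d + 1)) (b'.1 : Site (d + 1)) (Sum.inl b'.2) (Sum.inl b'.2) * perF M A (b.1, Sum.inl b.2) (b'.1, Sum.inl b'.2)))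
          (Matrix.of fun (b : ↥(pbox M) × Fin (d + 1)) (a : μ) =>
            axEc ρ Lc (b.1 : Site (d + 1)) (b.1 : Site (d + 1)) (Sum.inl b.2) (Sum.inl b.2) * perF M A (b.1, Sum.inl b.2) (fμ a))
          (-Matrix.of fun (a : μ) (b : ↥(pbox M) × Fin (d + 1)) =>
            axEc ρ Lc (b.1 : Site (d + 1)) (b.1 : Site (d + 1)) (Sum.inl b.2) (Sum.inl b.2) * perF M A (fμ a) (b.1, Sum.inl b.2))
          (-((perF M A).submatrix fμ fμ)))
        (fromBlocks
          (V.submatrix (fun b : ↥(pbox M) × Fin (d + 1) => ((b.1, Sum.inl b.2) : Idx M (Fib d)))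
            (fun b : ↥(pbox M) × Fin (d + 1) => ((b.1, Sum.inl b.2) : Idx M (Fib d))))
          (-(V.submatrix fμ (fun b : ↥(pbox M) × Fin (d + 1) => ((b.1, Sum.inl b.2) : Idx M (Fib d))))ᵀ)
          (V.submatrix fμ (fun b : ↥(pbox M) × Fin (d + 1) => ((b.1, Sum.inl b.2) : Idx M (Fib d)))) 0)
        (fromBlocks
          (V'.submatrix (fun b : ↥(pbox M) × Fin (d + 1) => ((b.1, Sum.inl b.2) : Idx M (Fib d)))
            (fun b : ↥(pbox M) × Fin (d + 1) => ((b.1, Sum.inl b.2) : Idx M (Fib d))))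
          (-(V'.submatrix fμ (fun b : ↥(pbox M) × Fin (d + 1) => ((b.1, Sum.inl b.2) : Idx M (Fib d))))ᵀ)
          (V'.submatrix fμ (fun b : ↥(pbox M) × Fin (d + 1) => ((b.1, Sum.inl b.2) : Idx M (Fib d)))) 0)
        (kkt
          (W.submatrix (fun b : ↥(pbox M) × Fin (d + 1) => ((b.1, Sum.inl b.2) : Idx M (Fib d)))
            (fun b : ↥(pbox M) × Fin (d + 1) => ((b.1, Sum.inl b.2) : Idx M (Fib d))))
          (W.submatrix fμ (fun b : ↥(pbox M) × Fin (d + 1) => ((b.1, Sum.inl b.2) : Idx M (Fib d)))))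
      = hessT (perF M A) V V' W := by
  rw [graded_blocks_eq_signTwist_submatrix M fμ hμ V hVm hVt, graded_blocks_eq_signTwist_submatrix M fμ hμ V' hV'm hV't,
    kkt_blocks_eq_signTwist_submatrix M fμ hμ W hWm hWt, hessT_packedLeg_eq_perF ρ M fμ hfμ hμ hcoarse hEA hAE]
  simp only [mul_signDiag_mul_signDiag]

end OneSystem

/-! ## §3 The socket: the packed `hessT` law of three systems ⟹ the law on the fibred torus indices, jets UNTWISTED -/

section Socket

variable {d : ℕ}

/-- [folklore] **`hessT_fullIndex_law_of_packed_law` — THE ASSEMBLY SOCKET (S3-3).**  Three systems `X ∈ {N, F, G}`, each with its torus `M_X`, root `ρ_X` and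
comb modulus `L_X` (live indicator `axEc ρ_X L_X`), packing injection `f_X : μ_X → Idx M_X (Fib d)` (injective, multiplier-valued, exactly over the root sites:
`hf hm hc`), chart kernel `A_X` under the torus rules `Ê·Â = Â = Â·Ê` (`hEA hAE` — leaf-05 `RelInvPeriodised*` ∕ an2 `perF_rules_comb` at the record), its
LEG `L_X` on the packed sorts DISPLAYED with the (S3-1) presentation `hL_X : L_X = fromBlocks Γ♯ I♯ L♯ (−S♯)` (leaf-06's packed leg over `perF M_X A_X`; the
adapters' `X_X.submatrix (Sum.map id inl)²`), FULL-INDEX jets `V_X V′_X` (`μμ`-free, SYMMETRIC twin) and `W_X` (`μμ`-free, ANTISYMMETRIC twin), and the door's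
BLOCKS `H₁ Q₁ H₁′ Q₁′ H₂ Q₂` DISPLAYED with the (S3-2) bindings `hH₁ : H₁ = V_X|ff`, `hQ₁ : Q₁ = V_X|μf`, … (an2's namings + #38∕#38b∕#38c).  IF the packed law
holds in the adapters' conclusion SHAPE — `hessT L_N (fromBlocks H₁ (−Q₁ᵀ) Q₁ 0) (fromBlocks H₁′ (−Q₁′ᵀ) Q₁′ 0) (kkt H₂ Q₂) = [F] + [G]` (#37 ∕ #37c VERBATIM at
their letters) — THEN `hessT (perF M_N A_N) V_N V′_N W_N = hessT (perF M_F A_F) V_F V′_F W_F + hessT (perF M_G A_G) V_G V′_G W_G`: (P2‴)'s `hlaw` currency,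
jets untwisted (`subst` the displayed equations; §2b ×3). -/
theorem hessT_fullIndex_law_of_packed_law
    -- system N (one-shot): torus, packing injection, chart kernel under the torus rules; the LEG on the packed sorts with its (S3-1) presentation;
    -- full-index jets with the parities; the door's BLOCKS with their (S3-2) bindings
    {μN : Type*} [Fintype μN] (ρN : Fin (d + 1) → ℤ) (LNc : ℕ) (MN : Fin (d + 1) → ℕ) [∀ i, NeZero (MN i)] (fN : μN → Idx MN (Fib d))
    (hfN : Function.Injective fN) (hmN : ∀ a : μN, ∃ m : Fin (d + 1), (fN a).2 = Sum.inr m)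
    (hcN : ∀ (s : ↥(pbox MN)) (m : Fin (d + 1)), ((s, Sum.inr m) : Idx MN (Fib d)) ∈ Set.range fN ↔ Torus.proj LNc (s : Site (d + 1)) = 0)
    {AN : MKer (d + 1) (Fib d)} (hEAN : perF MN (axEc ρN LNc) * perF MN AN = perF MN AN)
    (hAEN : perF MN AN * perF MN (axEc ρN LNc) = perF MN AN)
    (LN : Matrix ((↥(pbox MN) × Fin (d + 1)) ⊕ μN) ((↥(pbox MN) × Fin (d + 1)) ⊕ μN) ℝ)
    (hLN : LN = fromBlocks
      (Matrix.of fun (b b' : ↥(pbox MN) × Fin (d + 1)) =>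
        axEc ρN LNc (b.1 : Site (d + 1)) (b.1 : Site (d + 1)) (Sum.inl b.2) (Sum.inl b.2)
          * (axEc ρN LNc (b'.1 : Site (d + 1)) (b'.1 : Site (d + 1)) (Sum.inl b'.2) (Sum.inl b'.2) * perF MN AN (b.1, Sum.inl b.2) (b'.1, Sum.inl b'.2)))
      (Matrix.of fun (b : ↥(pbox MN) × Fin (d + 1)) (a : μN) =>
        axEc ρN LNc (b.1 : Site (d + 1)) (b.1 : Site (d + 1)) (Sum.inl b.2) (Sum.inl b.2) * perF MN AN (b.1, Sum.inl b.2) (fN a))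
      (-Matrix.of fun (a : μN) (b : ↥(pbox MN) × Fin (d + 1)) =>
        axEc ρN LNc (b.1 : Site (d + 1)) (b.1 : Site (d + 1)) (Sum.inl b.2) (Sum.inl b.2) * perF MN AN (fN a) (b.1, Sum.inl b.2))
      (-((perF MN AN).submatrix fN fN)))
    (VN VN' WN : Matrix (Idx MN (Fib d)) (Idx MN (Fib d)) ℝ)
    (hVNm : ∀ a a' : μN, VN (fN a) (fN a') = 0)
    (hVNt : ∀ (b : ↥(pbox MN) × Fin (d + 1)) (a : μN), VN (b.1, Sum.inl b.2) (fN a) = VN (fN a) (b.1, Sum.inl b.2))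
    (hVN'm : ∀ a a' : μN, VN' (fN a) (fN a') = 0)
    (hVN't : ∀ (b : ↥(pbox MN) × Fin (d + 1)) (a : μN), VN' (b.1, Sum.inl b.2) (fN a) = VN' (fN a) (b.1, Sum.inl b.2))
    (hWNm : ∀ a a' : μN, WN (fN a) (fN a') = 0)
    (hWNt : ∀ (b : ↥(pbox MN) × Fin (d + 1)) (a : μN), WN (b.1, Sum.inl b.2) (fN a) = -WN (fN a) (b.1, Sum.inl b.2))
    (HN₁ HN₁' HN₂ : Matrix (↥(pbox MN) × Fin (d + 1)) (↥(pbox MN) × Fin (d + 1)) ℝ) (QN₁ QN₁' QN₂ : Matrix μN (↥(pbox MN) × Fin (d + 1)) ℝ)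
    (hHN₁ : HN₁ = VN.submatrix (fun b : ↥(pbox MN) × Fin (d + 1) => ((b.1, Sum.inl b.2) : Idx MN (Fib d)))
      (fun b : ↥(pbox MN) × Fin (d + 1) => ((b.1, Sum.inl b.2) : Idx MN (Fib d))))
    (hQN₁ : QN₁ = VN.submatrix fN (fun b : ↥(pbox MN) × Fin (d + 1) => ((b.1, Sum.inl b.2) : Idx MN (Fib d))))
    (hHN₁' : HN₁' = VN'.submatrix (fun b : ↥(pbox MN) × Fin (d + 1) => ((b.1, Sum.inl b.2) : Idx MN (Fib d)))
      (fun b : ↥(pbox MN) × Fin (d + 1) => ((b.1, Sum.inl b.2) : Idx MN (Fib d))))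
    (hQN₁' : QN₁' = VN'.submatrix fN (fun b : ↥(pbox MN) × Fin (d + 1) => ((b.1, Sum.inl b.2) : Idx MN (Fib d))))
    (hHN₂ : HN₂ = WN.submatrix (fun b : ↥(pbox MN) × Fin (d + 1) => ((b.1, Sum.inl b.2) : Idx MN (Fib d)))
      (fun b : ↥(pbox MN) × Fin (d + 1) => ((b.1, Sum.inl b.2) : Idx MN (Fib d))))
    (hQN₂ : QN₂ = WN.submatrix fN (fun b : ↥(pbox MN) × Fin (d + 1) => ((b.1, Sum.inl b.2) : Idx MN (Fib d))))
    -- system F (fine): torus, packing injection, chart kernel under the torus rules; the LEG on the packed sorts with its (S3-1) presentation;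
    -- full-index jets with the parities; the door's BLOCKS with their (S3-2) bindings
    {μF : Type*} [Fintype μF] (ρF : Fin (d + 1) → ℤ) (LFc : ℕ) (MF : Fin (d + 1) → ℕ) [∀ i, NeZero (MF i)] (fF : μF → Idx MF (Fib d))
    (hfF : Function.Injective fF) (hmF : ∀ a : μF, ∃ m : Fin (d + 1), (fF a).2 = Sum.inr m)
    (hcF : ∀ (s : ↥(pbox MF)) (m : Fin (d + 1)), ((s, Sum.inr m) : Idx MF (Fib d)) ∈ Set.range fF ↔ Torus.proj LFc (s : Site (d + 1)) = 0)
    {AF : MKer (d + 1) (Fib d)} (hEAF : perF MF (axEc ρF LFc) * perF MF AF = perF MF AF)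
    (hAEF : perF MF AF * perF MF (axEc ρF LFc) = perF MF AF)
    (LF : Matrix ((↥(pbox MF) × Fin (d + 1)) ⊕ μF) ((↥(pbox MF) × Fin (d + 1)) ⊕ μF) ℝ)
    (hLF : LF = fromBlocks
      (Matrix.of fun (b b' : ↥(pbox MF) × Fin (d + 1)) =>
        axEc ρF LFc (b.1 : Site (d + 1)) (b.1 : Site (d + 1)) (Sum.inl b.2) (Sum.inl b.2)
          * (axEc ρF LFc (b'.1 : Site (d + 1)) (b'.1 : Site (d + 1)) (Sum.inl b'.2) (Sum.inl b'.2) * perF MF AF (b.1, Sum.inl b.2) (b'.1, Sum.inl b'.2)))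
      (Matrix.of fun (b : ↥(pbox MF) × Fin (d + 1)) (a : μF) =>
        axEc ρF LFc (b.1 : Site (d + 1)) (b.1 : Site (d + 1)) (Sum.inl b.2) (Sum.inl b.2) * perF MF AF (b.1, Sum.inl b.2) (fF a))
      (-Matrix.of fun (a : μF) (b : ↥(pbox MF) × Fin (d + 1)) =>
        axEc ρF LFc (b.1 : Site (d + 1)) (b.1 : Site (d + 1)) (Sum.inl b.2) (Sum.inl b.2) * perF MF AF (fF a) (b.1, Sum.inl b.2))
      (-((perF MF AF).submatrix fF fF)))
    (VF VF' WF : Matrix (Idx MF (Fib d)) (Idx MF (Fib d)) ℝ)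
    (hVFm : ∀ a a' : μF, VF (fF a) (fF a') = 0)
    (hVFt : ∀ (b : ↥(pbox MF) × Fin (d + 1)) (a : μF), VF (b.1, Sum.inl b.2) (fF a) = VF (fF a) (b.1, Sum.inl b.2))
    (hVF'm : ∀ a a' : μF, VF' (fF a) (fF a') = 0)
    (hVF't : ∀ (b : ↥(pbox MF) × Fin (d + 1)) (a : μF), VF' (b.1, Sum.inl b.2) (fF a) = VF' (fF a) (b.1, Sum.inl b.2))
    (hWFm : ∀ a a' : μF, WF (fF a) (fF a') = 0)
    (hWFt : ∀ (b : ↥(pbox MF) × Fin (d + 1)) (a : μF), WF (b.1, Sum.inl b.2) (fF a) = -WF (fF a) (b.1, Sum.inl b.2))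
    (HF₁ HF₁' HF₂ : Matrix (↥(pbox MF) × Fin (d + 1)) (↥(pbox MF) × Fin (d + 1)) ℝ) (QF₁ QF₁' QF₂ : Matrix μF (↥(pbox MF) × Fin (d + 1)) ℝ)
    (hHF₁ : HF₁ = VF.submatrix (fun b : ↥(pbox MF) × Fin (d + 1) => ((b.1, Sum.inl b.2) : Idx MF (Fib d)))
      (fun b : ↥(pbox MF) × Fin (d + 1) => ((b.1, Sum.inl b.2) : Idx MF (Fib d))))
    (hQF₁ : QF₁ = VF.submatrix fF (fun b : ↥(pbox MF) × Fin (d + 1) => ((b.1, Sum.inl b.2) : Idx MF (Fib d))))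
    (hHF₁' : HF₁' = VF'.submatrix (fun b : ↥(pbox MF) × Fin (d + 1) => ((b.1, Sum.inl b.2) : Idx MF (Fib d)))
      (fun b : ↥(pbox MF) × Fin (d + 1) => ((b.1, Sum.inl b.2) : Idx MF (Fib d))))
    (hQF₁' : QF₁' = VF'.submatrix fF (fun b : ↥(pbox MF) × Fin (d + 1) => ((b.1, Sum.inl b.2) : Idx MF (Fib d))))
    (hHF₂ : HF₂ = WF.submatrix (fun b : ↥(pbox MF) × Fin (d + 1) => ((b.1, Sum.inl b.2) : Idx MF (Fib d)))
      (fun b : ↥(pbox MF) × Fin (d + 1) => ((b.1, Sum.inl b.2) : Idx MF (Fib d))))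
    (hQF₂ : QF₂ = WF.submatrix fF (fun b : ↥(pbox MF) × Fin (d + 1) => ((b.1, Sum.inl b.2) : Idx MF (Fib d))))
    -- system G (coarse): torus, packing injection, chart kernel under the torus rules; the LEG on the packed sorts with its (S3-1) presentation;
    -- full-index jets with the parities; the door's BLOCKS with their (S3-2) bindings
    {μG : Type*} [Fintype μG] (ρG : Fin (d + 1) → ℤ) (LGc : ℕ) (MG : Fin (d + 1) → ℕ) [∀ i, NeZero (MG i)] (fG : μG → Idx MG (Fib d))
    (hfG : Function.Injective fG) (hmG : ∀ a : μG, ∃ m : Fin (d + 1), (fG a).2 = Sum.inr m)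
    (hcG : ∀ (s : ↥(pbox MG)) (m : Fin (d + 1)), ((s, Sum.inr m) : Idx MG (Fib d)) ∈ Set.range fG ↔ Torus.proj LGc (s : Site (d + 1)) = 0)
    {AG : MKer (d + 1) (Fib d)} (hEAG : perF MG (axEc ρG LGc) * perF MG AG = perF MG AG)
    (hAEG : perF MG AG * perF MG (axEc ρG LGc) = perF MG AG)
    (LG : Matrix ((↥(pbox MG) × Fin (d + 1)) ⊕ μG) ((↥(pbox MG) × Fin (d + 1)) ⊕ μG) ℝ)
    (hLG : LG = fromBlocks
      (Matrix.of fun (b b' : ↥(pbox MG) × Fin (d + 1)) =>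
        axEc ρG LGc (b.1 : Site (d + 1)) (b.1 : Site (d + 1)) (Sum.inl b.2) (Sum.inl b.2)
          * (axEc ρG LGc (b'.1 : Site (d + 1)) (b'.1 : Site (d + 1)) (Sum.inl b'.2) (Sum.inl b'.2) * perF MG AG (b.1, Sum.inl b.2) (b'.1, Sum.inl b'.2)))
      (Matrix.of fun (b : ↥(pbox MG) × Fin (d + 1)) (a : μG) =>
        axEc ρG LGc (b.1 : Site (d + 1)) (b.1 : Site (d + 1)) (Sum.inl b.2) (Sum.inl b.2) * perF MG AG (b.1, Sum.inl b.2) (fG a))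
      (-Matrix.of fun (a : μG) (b : ↥(pbox MG) × Fin (d + 1)) =>
        axEc ρG LGc (b.1 : Site (d + 1)) (b.1 : Site (d + 1)) (Sum.inl b.2) (Sum.inl b.2) * perF MG AG (fG a) (b.1, Sum.inl b.2))
      (-((perF MG AG).submatrix fG fG)))
    (VG VG' WG : Matrix (Idx MG (Fib d)) (Idx MG (Fib d)) ℝ)
    (hVGm : ∀ a a' : μG, VG (fG a) (fG a') = 0)
    (hVGt : ∀ (b : ↥(pbox MG) × Fin (d + 1)) (a : μG), VG (b.1, Sum.inl b.2) (fG a) = VG (fG a) (b.1, Sum.inl b.2))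
    (hVG'm : ∀ a a' : μG, VG' (fG a) (fG a') = 0)
    (hVG't : ∀ (b : ↥(pbox MG) × Fin (d + 1)) (a : μG), VG' (b.1, Sum.inl b.2) (fG a) = VG' (fG a) (b.1, Sum.inl b.2))
    (hWGm : ∀ a a' : μG, WG (fG a) (fG a') = 0)
    (hWGt : ∀ (b : ↥(pbox MG) × Fin (d + 1)) (a : μG), WG (b.1, Sum.inl b.2) (fG a) = -WG (fG a) (b.1, Sum.inl b.2))
    (HG₁ HG₁' HG₂ : Matrix (↥(pbox MG) × Fin (d + 1)) (↥(pbox MG) × Fin (d + 1)) ℝ) (QG₁ QG₁' QG₂ : Matrix μG (↥(pbox MG) × Fin (d + 1)) ℝ)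
    (hHG₁ : HG₁ = VG.submatrix (fun b : ↥(pbox MG) × Fin (d + 1) => ((b.1, Sum.inl b.2) : Idx MG (Fib d)))
      (fun b : ↥(pbox MG) × Fin (d + 1) => ((b.1, Sum.inl b.2) : Idx MG (Fib d))))
    (hQG₁ : QG₁ = VG.submatrix fG (fun b : ↥(pbox MG) × Fin (d + 1) => ((b.1, Sum.inl b.2) : Idx MG (Fib d))))
    (hHG₁' : HG₁' = VG'.submatrix (fun b : ↥(pbox MG) × Fin (d + 1) => ((b.1, Sum.inl b.2) : Idx MG (Fib d)))
      (fun b : ↥(pbox MG) × Fin (d + 1) => ((b.1, Sum.inl b.2) : Idx MG (Fib d))))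
    (hQG₁' : QG₁' = VG'.submatrix fG (fun b : ↥(pbox MG) × Fin (d + 1) => ((b.1, Sum.inl b.2) : Idx MG (Fib d))))
    (hHG₂ : HG₂ = WG.submatrix (fun b : ↥(pbox MG) × Fin (d + 1) => ((b.1, Sum.inl b.2) : Idx MG (Fib d)))
      (fun b : ↥(pbox MG) × Fin (d + 1) => ((b.1, Sum.inl b.2) : Idx MG (Fib d))))
    (hQG₂ : QG₂ = WG.submatrix fG (fun b : ↥(pbox MG) × Fin (d + 1) => ((b.1, Sum.inl b.2) : Idx MG (Fib d))))
    -- THE PACKED LAW, in the adapters' conclusion shape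
    (hlaw : hessT LN (fromBlocks HN₁ (-QN₁ᵀ) QN₁ 0) (fromBlocks HN₁' (-QN₁'ᵀ) QN₁' 0) (kkt HN₂ QN₂)
      = hessT LF (fromBlocks HF₁ (-QF₁ᵀ) QF₁ 0) (fromBlocks HF₁' (-QF₁'ᵀ) QF₁' 0) (kkt HF₂ QF₂)
        + hessT LG (fromBlocks HG₁ (-QG₁ᵀ) QG₁ 0) (fromBlocks HG₁' (-QG₁'ᵀ) QG₁' 0) (kkt HG₂ QG₂)) :
    hessT (perF MN AN) VN VN' WN = hessT (perF MF AF) VF VF' WF + hessT (perF MG AG) VG VG' WG := by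
  subst hLN hLF hLG hHN₁ hQN₁ hHN₁' hQN₁' hHN₂ hQN₂ hHF₁ hQF₁ hHF₁' hQF₁' hHF₂ hQF₂ hHG₁ hQG₁ hHG₁' hQG₁' hHG₂ hQG₂
  rw [hessT_packedLeg_blocks_eq_perF ρN MN fN hfN hmN hcN hEAN hAEN VN VN' WN hVNm hVNt hVN'm hVN't hWNm hWNt,
    hessT_packedLeg_blocks_eq_perF ρF MF fF hfF hmF hcF hEAF hAEF VF VF' WF hVFm hVFt hVF'm hVF't hWFm hWFt,
    hessT_packedLeg_blocks_eq_perF ρG MG fG hfG hmG hcG hEAG hAEG VG VG' WG hVGm hVGt hVG'm hVG't hWGm hWGt] at hlaw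
  exact hlaw

end Socket

end Summit.QuantumFields.BalabanUV.Beta.FP.PackedLawFullIndex

end
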